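import Mathlib
import HarnessLib
import Summits.AtomisticToContinuum.Crystallization.Theorems.PricedLinkCensusSoftFourRingsCapWings
import Summits.AtomisticToContinuum.Crystallization.Theorems.PricedLinkCensusSoftFourRingsHexagon1

/-!
# Soft four-rings, endgame: the cells of a type-A vertex end at the wings of its `γ`-partner

Support file for `SoftFourRings` (route `PricedLinkCensus`, sub-problem `Crystallization`),
endgame step (E3) of the evidence file (§12.8), point-level form.  For type-A data
`(a, b, c, d)` at `v` and type-A data `(a₃, b₃, c₃, v)` at the `γ`-partner `d`
(`typeA_gamma`):

* `typeA_swap` — the data `(c, b, a, d)` is again type-A data at `v`;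
* `wing_not_common` — a type-O vertex with a bonded pair `{d, m}` is not bonded to both of two
  non-bonded points `a ≠ c` outside `{d, m}`;
* `cells_end_at_wings` — **`a ∼ a₃` and `c ∼ c₃`, or `a ∼ c₃` and `c ∼ a₃`**: the two cells
  at `v` through the `γ`-bond `{v, d}` close up at the two wings of the `α`-bond of `d`;
* `typeO_typeA_false` — no vertex carries both type-O and type-A data;
* `common_of_alpha` — a common bond of `v` and its `α`-partner `b` is a wing `a` or `c`.

**`Cap` variant** (seat c3 of stmt-AtomisticToContinuum-14234): identical to `PricedLinkCensusSoftFourRingsHexagon1`, except that the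
global Tammes-13 hypothesis `(hT : musinTarasov2012_tammes_thirteen)` is replaced by the LOCAL covering
property of the twelve directions, `hT : ∀ p, ‖p‖ = 1 → ∃ x ∈ X, dist p x < 0.957` (no empty cap of
angular radius `57.18°`), which is all the two roots (`FacetCap`, `Interior`) ever used; the hT-free
lemmas are not repeated (the original file is imported for them).
-/

namespace Summit.AtomisticToContinuum.Crystallization.Theorems.Cap

open Real RealInnerProductSpace Literature.Geometry.DiscreteGeometry

section Pairs

end Pairs

section Setting

open scoped Classical in
/-- **The cells at a type-A vertex close up at the wings of the `γ`-partner's `α`-bond.** -/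
theorem cells_end_at_wings
    {X : Finset (EuclideanSpace ℝ (Fin 3))}
    {B : Finset (Finset (EuclideanSpace ℝ (Fin 3)))}
    (hT : ∀ p : EuclideanSpace ℝ (Fin 3), ‖p‖ = 1 → ∃ x ∈ X, dist p x < 0.957)
    (hX1 : ∀ y ∈ X, ‖y‖ = 1)
    (hcard : X.card = 12)
    (hsepX : ∀ u ∈ X, ∀ u' ∈ X, u ≠ u' → ⟪u, u'⟫ ≤ 1 - 1 / (2 * (101 / 100 : ℝ) ^ 2))
    (hB : ∀ T ∈ B, ∃ u ∈ X, ∃ u' ∈ X, u ≠ u' ∧ 1 - (101 / 100 : ℝ) ^ 2 / 2 ≤ ⟪u, u'⟫ ∧ T = {u, u'})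
    (hBcard : B.card = 24)
    (hdeg : ∀ v ∈ X, ∃ w : Fin 4 → EuclideanSpace ℝ (Fin 3), (∀ k, w k ∈ X) ∧ Function.Injective w ∧ (∀ k, w k ≠ v) ∧ (∀ k, ({v, w k} : Finset (EuclideanSpace ℝ (Fin 3))) ∈ B) ∧ ∀ y, ({v, y} : Finset (EuclideanSpace ℝ (Fin 3))) ∈ B → ∃ k, y = w k) {v a b c d a₃ b₃ c₃ : EuclideanSpace ℝ (Fin 3)} (hv : v ∈ X)
    (hN : ∀ y, ({v, y} : Finset (EuclideanSpace ℝ (Fin 3))) ∈ B ↔ (y = a ∨ y = b ∨ y = c ∨ y = d))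
    (hd : a ≠ b ∧ a ≠ c ∧ a ≠ d ∧ b ≠ c ∧ b ≠ d ∧ c ≠ d)
    (hab : ({a, b} : Finset (EuclideanSpace ℝ (Fin 3))) ∈ B)
    (hbc : ({b, c} : Finset (EuclideanSpace ℝ (Fin 3))) ∈ B)
    (hac : ({a, c} : Finset (EuclideanSpace ℝ (Fin 3))) ∉ B)
    (had : ({a, d} : Finset (EuclideanSpace ℝ (Fin 3))) ∉ B)
    (hbd : ({b, d} : Finset (EuclideanSpace ℝ (Fin 3))) ∉ B)
    (hcd : ({c, d} : Finset (EuclideanSpace ℝ (Fin 3))) ∉ B)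
    (hN₃ : ∀ y, ({d, y} : Finset (EuclideanSpace ℝ (Fin 3))) ∈ B ↔
      (y = a₃ ∨ y = b₃ ∨ y = c₃ ∨ y = v))
    (hd₃ : a₃ ≠ b₃ ∧ a₃ ≠ c₃ ∧ a₃ ≠ v ∧ b₃ ≠ c₃ ∧ b₃ ≠ v ∧ c₃ ≠ v)
    (hab₃ : ({a₃, b₃} : Finset (EuclideanSpace ℝ (Fin 3))) ∈ B)
    (hbc₃ : ({b₃, c₃} : Finset (EuclideanSpace ℝ (Fin 3))) ∈ B)
    (hac₃ : ({a₃, c₃} : Finset (EuclideanSpace ℝ (Fin 3))) ∉ B)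
    (hav₃ : ({a₃, v} : Finset (EuclideanSpace ℝ (Fin 3))) ∉ B)
    (hbv₃ : ({b₃, v} : Finset (EuclideanSpace ℝ (Fin 3))) ∉ B)
    (hcv₃ : ({c₃, v} : Finset (EuclideanSpace ℝ (Fin 3))) ∉ B) :
    (({a, a₃} : Finset (EuclideanSpace ℝ (Fin 3))) ∈ B ∧
      ({c, c₃} : Finset (EuclideanSpace ℝ (Fin 3))) ∈ B) ∨
    (({a, c₃} : Finset (EuclideanSpace ℝ (Fin 3))) ∈ B ∧
      ({c, a₃} : Finset (EuclideanSpace ℝ (Fin 3))) ∈ B) := by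
  obtain ⟨⟨x₁, -, hx₁v, hx₁a, hx₁b, hx₁c, hx₁d, hx₁B, hx₁Ba, hf₁⟩,
    ⟨x₂, -, hx₂v, hx₂a, hx₂b, hx₂c, hx₂d, hx₂B, hx₂Bc, hf₂⟩⟩ :=
    typeA_cells hT hX1 hcard hsepX hB hBcard hdeg hv hN hd hab hbc hac had hbd hcd
  have h₁ := wing_cell hT hX1 hcard hsepX hB hBcard hN₃ hd₃ hab₃ hbc₃ hx₁v hx₁B hf₁
  have h₂ := wing_cell hT hX1 hcard hsepX hB hBcard hN₃ hd₃ hab₃ hbc₃ hx₂v hx₂B hf₂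
  -- the two cell points are different wings
  have hdb₃ : ({d, b₃} : Finset (EuclideanSpace ℝ (Fin 3))) ∈ B := (hN₃ b₃).2 (Or.inr (Or.inl rfl))
  have had' : a ≠ d := hd.2.2.1
  have hcd' : c ≠ d := hd.2.2.2.2.2
  have hab₃' : a ≠ b₃ := fun h => had (by rw [h, Finset.pair_comm]; exact hdb₃)
  have hcb₃' : c ≠ b₃ := fun h => hcd (by rw [h, Finset.pair_comm]; exact hdb₃)
  have hne : x₁ ≠ x₂ := by
    intro heq
    rw [← heq] at hx₂Bc
    -- `x₁` is a wing of `{d, b₃}`, of type O with bonded pair `{d, b₃}`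
    rcases h₁ with rfl | rfl
    · obtain ⟨p, q, hNw, -, -, hpq, -⟩ :=
        typeA_wing hT hX1 hcard hsepX hB hBcard hdeg hN₃ hd₃ hab₃ hbc₃ hac₃ hav₃ hbv₃
      exact wing_not_common hNw hpq hac hd.2.1 had' hab₃' hcd' hcb₃' hx₁Ba hx₂Bc
    · obtain ⟨hN₃', hd₃', hcb₃, hba₃, hca₃, hcv₃', hbv₃', hav₃'⟩ :=
        typeA_swap hN₃ hd₃ hab₃ hbc₃ hac₃ hav₃ hbv₃ hcv₃
      obtain ⟨p, q, hNw, -, -, hpq, -⟩ :=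
        typeA_wing hT hX1 hcard hsepX hB hBcard hdeg hN₃' hd₃' hcb₃ hba₃ hca₃ hcv₃' hbv₃'
      exact wing_not_common hNw hpq hac hd.2.1 had' hab₃' hcd' hcb₃' hx₁Ba hx₂Bc
  rcases h₁ with rfl | rfl <;> rcases h₂ with rfl | rfl
  · exact absurd rfl hne
  · exact Or.inl ⟨by rw [Finset.pair_comm]; exact hx₁Ba, by rw [Finset.pair_comm]; exact hx₂Bc⟩
  · exact Or.inr ⟨by rw [Finset.pair_comm]; exact hx₁Ba, by rw [Finset.pair_comm]; exact hx₂Bc⟩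
  · exact absurd rfl hne

end Setting

section PairsB

end PairsB

end Summit.AtomisticToContinuum.Crystallization.Theorems.Cap
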